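import Literature.MathematicalPhysics.QuantumFieldTheory.Balaban1983to89.B12Average012QtildeCovariance
import Literature.MathematicalPhysics.QuantumFieldTheory.Balaban1983to89.B12LinearizationGenuineZd
import Literature.MathematicalPhysics.QuantumLattice.LatticeGaugeDLRProofs

/-!
# `Balaban1983to89.B12Def267Covariance` — [Balaban1987RG1] p. 267 / (2.16) p. 269: the p. 267 letters of the
linearizing change of variables are COVARIANT under the gauge transformations (2.16) — the corridor operator `h`
(«LQ̃h = I … h is uniquely defined by these conditions»): `h_{V^u}(R(u)B) = R(u)(h_V B)`, from print's own uniqueness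
sentence; the remainder `C̃ = Q̃ − LQ̃` («LQ̃B′ + C̃(B′)»): `C̃_{V^u}(R(u)B′) = R(u)C̃_V(B′)` on the quantitative
small-field ball; and the solution `D̃` of «LQ̃B − D̃(B) + C̃(B − hD̃(B)) = LQ̃B» («there exists exactly one solution»):
`D̃_{V^u}(R(u)B) = R(u)D̃_V(B)` — PROVED

statement-level skeleton of published theorems with citation tags; proofs where landed; nothing here is a claim about the Yang–Mills mass gap

CITATION HEADER.  T. Bałaban, *Renormalization group approach to lattice gauge field theories. I. Generation of
effective actions in a small field approximation and a coupling constant renormalization in four dimensions*,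
Commun. Math. Phys. **109** (1987) 249–301, doi:10.1007/bf01215223 [Balaban1987RG1] (cell paper B12; held text
`paper:balaban1987-cmp109-rg-i-small-field`, journal page = PDF page + 248; p. 267 [PDF 19] and p. 269 [PDF 21] re-read
from the text layer `p0019.txt` / `p0021.txt` for this file).  Unit `lit-balaban-r09` gen 45 (display owner of CMP 109;
TAKING #2 line `HOME/STATUS.md` 2026-08-23T20:31:42Z, filed under this name), HOME `run/shared/lean/pub/lit-balaban/`;
SKELETON rows `B12.Def@267` (the letters `h`, `C̃`, `D̃`), `B12.Eq2.16` (cells only) and GAPS entry G-B12-09 (ii) («the covariance under u of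
B12's own letters h and C̃⁽²⁾ ∕ D̃ … follows in print from the covariance of Q̃ … but is NOT stated as a theorem»).

WHAT IS PRINTED (verbatim, «…»).
* p. 267 [PDF 19]: *«At first we introduce an operator h. It transforms 𝐠-valued functions B defined at bonds of the
  lattice T⁽ᵏ⁺¹⁾ into such functions defined at bonds of T⁽ᵏ⁾. The function hB is equal to 0 everywhere, except the
  set {b₀(c) : c ∈ T⁽ᵏ⁺¹⁾}. […] Furthermore, the operator h satisfies the identity LQ̃h = I on T⁽ᵏ⁺¹⁾. Of course h is
  uniquely defined by these conditions, in fact it is a very simple operator given by the equality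
  (hB)(b₀(c)) = h(c)B(c), where h(c) is a linear operator on the Lie algebra 𝐠 … We are looking for an analytic,
  𝐠-valued function D̃(B′), defined at bonds of T⁽ᵏ⁺¹⁾, and such that the transformation B′ = B − hD̃(B) linearizes
  the function Q̃(B′). The function D̃(B) is determined by the equation LQ̃B′ + C̃(B′) = LQ̃B − D̃(B) + C̃(B − hD̃(B))
  = LQ̃B.»* (so `C̃(B′) = Q̃(B′) − LQ̃B′`, the nonlinear remainder of (2.4)).
* p. 269 [PDF 21]: *«… all the expressions in (2.12), together with the measure, are invariant with respect to the
  gauge transformations U_{k+1} → U^u_{k+1}, B′ → R(u)B′, (R(u)B′)(b) = R(u(b₋))B′(b). (2.16)»* — among the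
  expressions of (2.12) p. 268: `H₁hD̃(g_kCB)`, `H₁g_kCB`, built from `h` (and `C`, `D̃`).

DICTIONARY print → Lean (all PRE-EXISTING, consumed by name; nothing restated).  The `ℤᵈ` corner-cube carrier of the
b12 lineage: fine bonds `ZdEdge d`, coarse bonds `c : ZdEdge d` with corner `L·c₋ = blockBase L c.1`, the corridor bond
`b₀(c) = B13CorridorSeparation.b0Z L c`; `V^u` ↦ `QuantumLattice.gaugeTransformZd u V` (`(V^u)^{u⁻¹} = V` ↦
`QuantumLattice.gaugeTransformZd_inv_gaugeTransformZd`, `LatticeGaugeDLRProofs`); `(R(u)B′)(b) = u(b₋)B′(b)u(b₋)⁻¹`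
↦ `B12Average012Covariance.rotB u B′` (on the coarse field `B` the same formula with `u(L·c₋)`, i.e. `rotB (u ∘ blockBase L)`);
`LQ̃_V` ↦ `B12AverageCorridor267.LQ L 𝐔 V` for print's average `𝐔 = B12ContourAverage253.Tavg`; `h(c)` ↦
`B12ContourAverage253.hAverage … V … c`; `h` ↦ `B13PkLocalTerms.hOp (b0Z L) h(·)`; «0 everywhere except {b₀(c)}» ↦
`B12HOperator267.CorridorSupported`; the `h`-paragraph (existence «LQ̃h = I», UNIQUENESS, bound) ↦
`B12ContourAverage253.h_paragraph_p267_average`; the (2.16)-covariance of `LQ̃` ↦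
`B12Average012QtildeCovariance.LQ_gaugeTransformZd` (r09 g9); `Q̃_V(B′)(c)` ↦ `B12AverageCorridor267.Qtilde`, its
finite (2.16)-covariance ↦ `B12Average012Covariance.Qtilde_gaugeTransformZd` (inside the logarithm's domain); the domain
facts on the ball ↦ `B12LQLocalityBound267.norm_pert_smul_sub_le` / `norm_loopW_sub_le` / `norm_loopW_Tavg_sub_one_le_all`
/ `norm_avgM_mul_inv_sub_one_le` (r09 g11); the `ℓ^∞` packaging `BField`, `hfield`, `Cfield` and the existence /
uniqueness package of `D̃` ↦ `B12LinearizationGenuineZd.p267_genuine` (r09 g11; `D̃` is given there EXISTENTIALLY with a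
uniqueness clause, so § 4 quantifies over any solution at `V` and the unique one at `V^u`).

THE ARGUMENT FORMALISED (print's «Of course h is uniquely defined by these conditions»).  For a `U1`-valued
`ε₀`-regular background `V` and a `U1`-valued gauge function `u`, the transformed background `V^u` is again
`U1`-valued and `ε₀`-regular (plaquette variables are conjugated), so both `h_V` and `h_{V^u}` exist.  Put
`𝒽 B := R(u)⁻¹ h_{V^u}(R(u)B)`.  It is corridor-supported (the rotations act bondwise), and it is a right inverse of
`LQ̃_V`: by the covariance of `LQ̃` at the pair `(V^u, u⁻¹)` — `(V^u)^{u⁻¹} = V` —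
`LQ̃_V(R(u)⁻¹Y)(c) = u(Lc₋)⁻¹ LQ̃_{V^u}(Y)(c) u(Lc₋)` and `LQ̃_{V^u}(h_{V^u}(R(u)B)) = R(u)B`.  By uniqueness `𝒽 = h_V`,
i.e. `h_{V^u}(R(u)B) = R(u)(h_V B)`.  For `C̃ = Q̃ − LQ̃`: on the ball `sup_b ‖B′(b)‖·dL ≤ 1/1200` (the ball of
`B12LinearizationGenuineZd.Cfield`) at an `ε₀`-regular `V` with `(dL)²ε₀ ≤ 1/200`, the perturbed (0.12) loops and the
ratio `M(V′V)M(V)⁻¹` lie inside the logarithm's domain (the domain facts of `B12QtildeRemainder123.analyticAt_Qtilde_smul`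
at `s = 1`), so the finite covariance of `Q̃` applies, and that of `LQ̃`; subtract.  For `D̃`: `R(u)` is an
isometry of `ℓ^∞`, so `X := R(u)D̃_V(B)` lies in the same ball and, by the covariance of `h` and `C̃`,
`C̃_{V^u}(R(u)B − h_{V^u}X) = R(u)C̃_V(B − h_VD̃_V(B)) = X`; uniqueness at `V^u` gives `X = D̃_{V^u}(R(u)B)`.

WHAT THIS MODULE PROVES (kernel-checked; no `sorry`; no `Prop` fact; one auxiliary definition WITH BODY (`rotBF`, § 4);
axioms standard).
* § 1 elementary transport: `mem_U1_gaugeTransformZd` (`V^u` is `U1`-valued), `plaq_gaugeTransformZd_le` (`V^u` is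
  `ε₀`-regular), `rotB_inv_rotB` / `rotB_rotB_inv` (`R(u)R(u⁻¹) = R(u⁻¹)R(u) = 1`), `corridorSupported_rotB_hOp`
  (support is kept by bondwise rotations).
* § 2 **`hOp_hAverage_gaugeTransformZd`** — `h_{V^u}(R(u)B) = R(u)(h_V B)` as fields on the fine bonds, for every
  coarse field `B`; **`hAverage_gaugeTransformZd_apply`** — the fibre form
  `h_{V^u}(c)(u(Lc₋) X u(Lc₋)⁻¹) = u(b₀(c)₋) (h_V(c) X) u(b₀(c)₋)⁻¹`.
* § 3 **`Qtilde_gaugeTransformZd_of_ball`** (the finite covariance of `Q̃` with its domain hypotheses DISCHARGED on the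
  ball `sup‖B′‖·dL ≤ 1/1200`) and **`Ctilde_gaugeTransformZd`** —
  `[Q̃ − LQ̃]_{V^u}(R(u)B′)(c) = u(Lc₋) [Q̃ − LQ̃]_V(B′)(c) u(Lc₋)⁻¹` on that ball.
* § 4 `rotBF` ((2.16) as a self-map of `ℓ^∞`, WITH BODY; `norm_rotBF` isometry, `rotBF_sub`, `rotBF_inv_rotBF`),
  **`hfield_gaugeTransformZd`**, **`Cfield_gaugeTransformZd`** (the `ℓ^∞` maps of `B12LinearizationGenuineZd` are
  covariant), **`Dtilde_gaugeTransformZd`** (`D̃_{V^u}(R(u)B) = R(u)D̃_V(B)` for `‖B‖ < ε`, for any solution `D̃_V` of the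
  fixed-point package at `V` and the unique one `D̃_{V^u}` at `V^u` — the two clauses of `p267_genuine`).

HONEST SCOPE / NOT PROVED HERE.  (a) `ℤᵈ` corner cubes and the lineage's (0.10)–(0.12) average
(`B12ContourAverage253` (a)–(c)), `U1`-valued `V`, `u` in a complete normed `ℂ`-algebra `𝔸` with `‖1‖ = 1`;
hypotheses as in `h_paragraph_p267_average` and `LQ_gaugeTransformZd`: `(dL)²ε₀ < 1/100`, `ω_A(ε₀) ≤ 1/8`,
`(Lᵈ/L)·24ω_A(ε₀) < 1`, `d ≥ 1` (§ 2); `(dL)²ε₀ ≤ 1/200` and `sup‖B′‖·dL ≤ 1/1200` (§§ 3–4).  (b) NOT treated: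
the quadratic part `C̃⁽²⁾ = D̃⁽²⁾` as a separate letter (the tree has no body for it beyond `Cfield` and the cubic
estimate `‖D̃(B) − C̃(B)‖ ≤ 36C₂²H‖B‖³` of `p267_genuine`), and `V` of (2.8) (GAPS G-B12-09 (iii) for `V`).  (c) § 2 is
stated for ARBITRARY witnesses of the hypotheses of `hAverage` at `V` and at `V^u` (so that it rewrites the packaged
maps of § 4); § 1 supplies witnesses.  (d) The torus, the infinite-dimensional analyticity of `D̃`, anything of the
series: not asserted.
-/

noncomputable section

open NormedSpace Finset Filter

namespace Literature.MathematicalPhysics.QuantumFieldTheory.Balaban1983to89.B12Def267Covariance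

open Literature.MathematicalPhysics.QuantumLattice (ZdEdge blockBase plaquetteHolonomyZd gaugeTransformZd
  plaquetteHolonomyZd_gaugeTransformZd gaugeTransformZd_inv_gaugeTransformZd)
open B7Prop1Explicit (U1 mem_U1)
open B12AverageCorridor267 (LQ Qtilde pert loopW offAxis avgM mem_blockSites_of_mem_offAxis)
open B12ContourAverage253 (Tavg omegaA hAverage h_paragraph_p267_average)
open B12SmallFieldRegion255 (avgBar)
open B12Average012Covariance (rotB rotB_apply norm_plaq_gaugeTransformZd_sub_one_le Qtilde_gaugeTransformZd)
open B12LQLocalityBound267 (norm_pert_smul_sub_le norm_loopW_sub_le norm_loopW_Tavg_sub_one_le_all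
  norm_avgM_mul_inv_sub_one_le)
open B12Average012QtildeCovariance (LQ_gaugeTransformZd)
open B12HOperator267 (CorridorSupported)
open B13PkLocalTerms (hOp hOp_apply_b₀ hOp_eq_zero_off_range)
open B13CorridorSeparation (b0Z b0Z_injective)

variable {d : ℕ}
variable {𝔸 : Type*} [NormedRing 𝔸] [NormedAlgebra ℂ 𝔸] [NormOneClass 𝔸] [CompleteSpace 𝔸] {L : ℕ}

/-! ## § 1  Elementary transport under (2.16) on the `ℤᵈ` carrier -/

omit [NormedAlgebra ℂ 𝔸] [CompleteSpace 𝔸] in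
/-- `V^u` is `U1`-valued when `V` and `u` are (the subgroup `U1` of units of norm `≤ 1` with inverse of norm `≤ 1`).
[cite: Balaban1985Averaging, (8) p.18] -/
theorem mem_U1_gaugeTransformZd {V : ZdEdge d → 𝔸ˣ} (hV : ∀ b, V b ∈ U1 𝔸) {u : (Fin d → ℤ) → 𝔸ˣ}
    (hu : ∀ z, u z ∈ U1 𝔸) (b : ZdEdge d) : gaugeTransformZd u V b ∈ U1 𝔸 :=
  (U1 𝔸).mul_mem ((U1 𝔸).mul_mem (hu _) (hV b)) ((U1 𝔸).inv_mem (hu _))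

omit [NormedAlgebra ℂ 𝔸] [CompleteSpace 𝔸] in
/-- `V^u` is `ε₀`-regular when `V` is («|V₀(∂p) − 1| = |V(∂p) − 1|»: plaquette variables are conjugated at the base
point). [cite: Balaban1985Averaging, (45) p.24] -/
theorem plaq_gaugeTransformZd_le (V : ZdEdge d → 𝔸ˣ) {u : (Fin d → ℤ) → 𝔸ˣ} (hu : ∀ z, u z ∈ U1 𝔸) {ε₀ : ℝ}
    (h44 : ∀ (p : Fin d → ℤ) (i j : Fin d), i ≠ j → ‖((plaquetteHolonomyZd V p i j : 𝔸ˣ) : 𝔸) - 1‖ ≤ ε₀)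
    (p : Fin d → ℤ) (i j : Fin d) (hij : i ≠ j) :
    ‖((plaquetteHolonomyZd (gaugeTransformZd u V) p i j : 𝔸ˣ) : 𝔸) - 1‖ ≤ ε₀ :=
  (norm_plaq_gaugeTransformZd_sub_one_le V hu p i j).trans (h44 p i j hij)

omit [NormedAlgebra ℂ 𝔸] [NormOneClass 𝔸] [CompleteSpace 𝔸] in
/-- `R(u)(R(u⁻¹)Y) = Y` for the bondwise adjoint action (2.16). [cite: Balaban1987RG1, (2.16) p.269] -/
theorem rotB_rotB_inv (u : (Fin d → ℤ) → 𝔸ˣ) (Y : ZdEdge d → 𝔸) :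
    rotB u (rotB u⁻¹ Y) = Y := by
  funext b
  simp only [rotB_apply, Pi.inv_apply, inv_inv, ← mul_assoc, Units.mul_inv, one_mul]
  rw [mul_assoc, Units.mul_inv, mul_one]

omit [NormedAlgebra ℂ 𝔸] [NormOneClass 𝔸] [CompleteSpace 𝔸] in
/-- `R(u⁻¹)(R(u)Y) = Y` for the bondwise adjoint action (2.16). [cite: Balaban1987RG1, (2.16) p.269] -/
theorem rotB_inv_rotB (u : (Fin d → ℤ) → 𝔸ˣ) (Y : ZdEdge d → 𝔸) :
    rotB u⁻¹ (rotB u Y) = Y := by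
  funext b
  simp only [rotB_apply, Pi.inv_apply, inv_inv, ← mul_assoc, Units.inv_mul, one_mul]
  rw [mul_assoc, Units.inv_mul, mul_one]

omit [NormedAlgebra ℂ 𝔸] [NormOneClass 𝔸] [CompleteSpace 𝔸] in
/-- «The function hB is equal to 0 everywhere, except the set {b₀(c)}» is preserved by bondwise rotations on both
sides: `B ↦ R(w)(hOp b₀ h (R(w′)B))` is corridor-supported. [cite: Balaban1987RG1, p.267] -/
theorem corridorSupported_rotB_hOp (L : ℕ) (w w' : (Fin d → ℤ) → 𝔸ˣ) (h : ZdEdge d → 𝔸 → 𝔸) :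
    CorridorSupported L (fun B : ZdEdge d → 𝔸 => rotB w (hOp (b0Z (d := d) L) h (rotB w' B))) := by
  intro B b hb
  show rotB w (hOp (b0Z L) h (rotB w' B)) b = 0
  rw [rotB_apply, hOp_eq_zero_off_range _ _ hb, mul_zero, zero_mul]

/-! ## § 2  The covariance of `h` under (2.16), by uniqueness -/

/-- **THE OPERATOR `h` OF P. 267 IS COVARIANT UNDER THE GAUGE TRANSFORMATIONS (2.16)**: for a `U1`-valued
`ε₀`-regular background `V` (`(dL)²ε₀ < 1/100`, `d ≥ 1`) and a `U1`-valued gauge function `u`, the corridor operator at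
the transformed background applied to the rotated coarse field is the rotated corridor operator:
`h_{V^u}(R(u)B) = R(u)(h_V B)`, where `R(u)` acts on coarse fields by `u(L·c₋)` and on fine fields by `u(b₋)` — for
ANY witnesses of the hypotheses of `hAverage` at `V` and at `V^u` (`‖·‖ ≤ 1`, regularity, `ω_A(ε₀) ≤ 1/8`, Neumann
budget; § 1 supplies some).  PROOF = print's «Of course h is uniquely defined by these conditions»:
`R(u)⁻¹ ∘ h_{V^u} ∘ R(u)` is a corridor-supported right inverse of `LQ̃_V` (covariance of `LQ̃`, `LQ_gaugeTransformZd`, at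
`(V^u, u⁻¹)`), hence equals `h_V` (`h_paragraph_p267_average`, clause (ii)). [cite: Balaban1987RG1, p.267] -/
theorem hOp_hAverage_gaugeTransformZd (hL : 0 < L) (hd : 1 ≤ d) (V : ZdEdge d → 𝔸ˣ) (hV : ∀ b, V b ∈ U1 𝔸)
    {u : (Fin d → ℤ) → 𝔸ˣ} (hu : ∀ z, u z ∈ U1 𝔸) {ε₀ : ℝ} (hε₀ : 0 ≤ ε₀)
    (hsm : ((d : ℝ) * L) ^ 2 * ε₀ < 1 / 100)
    (h44 : ∀ (p : Fin d → ℤ) (i j : Fin d), i ≠ j → ‖((plaquetteHolonomyZd V p i j : 𝔸ˣ) : 𝔸) - 1‖ ≤ ε₀)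
    (hV₁ : ∀ b, ‖((V b : 𝔸ˣ) : 𝔸)‖ ≤ 1) (hV₂ : ∀ b, ‖(((V b)⁻¹ : 𝔸ˣ) : 𝔸)‖ ≤ 1)
    (hsmV : ((d : ℝ) * L) ^ 2 * ε₀ ≤ 1 / 100) (hωV : omegaA d L ε₀ ≤ 1 / 8)
    (hbudV : (L : ℝ) ^ d / L * (24 * omegaA d L ε₀) < 1)
    (hU₁ : ∀ b, ‖((gaugeTransformZd u V b : 𝔸ˣ) : 𝔸)‖ ≤ 1)
    (hU₂ : ∀ b, ‖(((gaugeTransformZd u V b)⁻¹ : 𝔸ˣ) : 𝔸)‖ ≤ 1)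
    (h44U : ∀ (p : Fin d → ℤ) (i j : Fin d), i ≠ j →
      ‖((plaquetteHolonomyZd (gaugeTransformZd u V) p i j : 𝔸ˣ) : 𝔸) - 1‖ ≤ ε₀)
    (hsmU : ((d : ℝ) * L) ^ 2 * ε₀ ≤ 1 / 100) (hωU : omegaA d L ε₀ ≤ 1 / 8)
    (hbudU : (L : ℝ) ^ d / L * (24 * omegaA d L ε₀) < 1)
    (B : ZdEdge d → 𝔸) :
    hOp (b0Z L) (fun c X => hAverage hL hd (gaugeTransformZd u V) hU₁ hU₂ hε₀ h44U hsmU hωU hbudU c X)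
        (rotB (fun y => u (blockBase L y)) B)
      = rotB u (hOp (b0Z L) (fun c X => hAverage hL hd V hV₁ hV₂ hε₀ h44 hsmV hωV hbudV c X) B) := by
  -- the `h`-paragraphs at `V^u` and at `V` («LQ̃h = I» there, uniqueness here)
  obtain ⟨hiU, -, -⟩ := h_paragraph_p267_average hL hd (gaugeTransformZd u V) hU₁ hU₂ hε₀ h44U hsmU hωU hbudU
  obtain ⟨-, huniq, -⟩ := h_paragraph_p267_average hL hd V hV₁ hV₂ hε₀ h44 hsmV hωV hbudV
  -- name the two fibre families (opaque from here on)
  generalize hUdef : (fun c X => hAverage hL hd (gaugeTransformZd u V) hU₁ hU₂ hε₀ h44U hsmU hωU hbudU c X) = hU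
    at hiU ⊢
  generalize hV0def : (fun c X => hAverage hL hd V hV₁ hV₂ hε₀ h44 hsmV hωV hbudV c X) = hV0 at huniq ⊢
  -- the candidate `𝒽 = R(u)⁻¹ ∘ h_{V^u} ∘ R(u)`
  set w : (Fin d → ℤ) → 𝔸ˣ := fun y => u (blockBase L y) with hwdef
  set 𝒽 : (ZdEdge d → 𝔸) → ZdEdge d → 𝔸 :=
    fun B => rotB u⁻¹ (hOp (b0Z L) hU (rotB w B)) with h𝒽def
  have hs : CorridorSupported L 𝒽 := by
    rw [h𝒽def]
    exact corridorSupported_rotB_hOp L _ _ _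
  -- right inverse of `LQ̃_V`, by the covariance of `LQ̃` at `(V^u, u⁻¹)`
  have hinv : ∀ B c, LQ L (fun U : ZdEdge d → 𝔸ˣ => Tavg L U) V (𝒽 B) c = B c := by
    intro B c
    have hcov := LQ_gaugeTransformZd hL hd (gaugeTransformZd u V) (mem_U1_gaugeTransformZd hV hu)
      (v := u⁻¹) (fun z => (U1 𝔸).inv_mem (hu z)) hε₀ hsm h44U
      (hOp (b0Z L) hU (rotB w B)) c
    rw [gaugeTransformZd_inv_gaugeTransformZd] at hcov
    simp only [Pi.inv_apply, inv_inv] at hcov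
    rw [h𝒽def]
    show LQ L (fun U : ZdEdge d → 𝔸ˣ => Tavg L U) V
        (rotB u⁻¹ (hOp (b0Z L) hU (rotB w B))) c = B c
    rw [hcov, hiU, rotB_apply]
    simp only [hwdef, ← mul_assoc, Units.inv_mul, one_mul]
    rw [mul_assoc, Units.inv_mul, mul_one]
  -- uniqueness: `𝒽 = h_V`
  have heq : 𝒽 = hOp (b0Z L) hV0 := huniq 𝒽 hs hinv
  have hB : 𝒽 B = hOp (b0Z L) hV0 B := congrFun heq B
  rw [h𝒽def] at hB
  calc hOp (b0Z L) hU (rotB w B)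
      = rotB u (rotB u⁻¹ (hOp (b0Z L) hU (rotB w B))) := (rotB_rotB_inv u _).symm
    _ = rotB u (hOp (b0Z L) hV0 B) := by rw [← hB]

/-- **THE FIBRE FORM**: «(hB)(b₀(c)) = h(c)B(c)» — at the corridor bond `b₀(c)` the covariance reads
`h_{V^u}(c)(u(Lc₋) X u(Lc₋)⁻¹) = u(b₀(c)₋) (h_V(c) X) u(b₀(c)₋)⁻¹` for every `X` (the coarse rotation at `c` is
by `u(Lc₋)`, the fine one at `b₀(c)` by `u(b₀(c)₋)`), any witnesses. [cite: Balaban1987RG1, p.267] -/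
theorem hAverage_gaugeTransformZd_apply (hL : 0 < L) (hd : 1 ≤ d) (V : ZdEdge d → 𝔸ˣ) (hV : ∀ b, V b ∈ U1 𝔸)
    {u : (Fin d → ℤ) → 𝔸ˣ} (hu : ∀ z, u z ∈ U1 𝔸) {ε₀ : ℝ} (hε₀ : 0 ≤ ε₀)
    (hsm : ((d : ℝ) * L) ^ 2 * ε₀ < 1 / 100)
    (h44 : ∀ (p : Fin d → ℤ) (i j : Fin d), i ≠ j → ‖((plaquetteHolonomyZd V p i j : 𝔸ˣ) : 𝔸) - 1‖ ≤ ε₀)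
    (hV₁ : ∀ b, ‖((V b : 𝔸ˣ) : 𝔸)‖ ≤ 1) (hV₂ : ∀ b, ‖(((V b)⁻¹ : 𝔸ˣ) : 𝔸)‖ ≤ 1)
    (hsmV : ((d : ℝ) * L) ^ 2 * ε₀ ≤ 1 / 100) (hωV : omegaA d L ε₀ ≤ 1 / 8)
    (hbudV : (L : ℝ) ^ d / L * (24 * omegaA d L ε₀) < 1)
    (hU₁ : ∀ b, ‖((gaugeTransformZd u V b : 𝔸ˣ) : 𝔸)‖ ≤ 1)
    (hU₂ : ∀ b, ‖(((gaugeTransformZd u V b)⁻¹ : 𝔸ˣ) : 𝔸)‖ ≤ 1)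
    (h44U : ∀ (p : Fin d → ℤ) (i j : Fin d), i ≠ j →
      ‖((plaquetteHolonomyZd (gaugeTransformZd u V) p i j : 𝔸ˣ) : 𝔸) - 1‖ ≤ ε₀)
    (hsmU : ((d : ℝ) * L) ^ 2 * ε₀ ≤ 1 / 100) (hωU : omegaA d L ε₀ ≤ 1 / 8)
    (hbudU : (L : ℝ) ^ d / L * (24 * omegaA d L ε₀) < 1)
    (c : ZdEdge d) (X : 𝔸) :
    hAverage hL hd (gaugeTransformZd u V) hU₁ hU₂ hε₀ h44U hsmU hωU hbudU c
        ((u (blockBase L c.1) : 𝔸) * X * (((u (blockBase L c.1))⁻¹ : 𝔸ˣ) : 𝔸))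
      = (u (b0Z L c).1 : 𝔸) * hAverage hL hd V hV₁ hV₂ hε₀ h44 hsmV hωV hbudV c X
          * (((u (b0Z L c).1)⁻¹ : 𝔸ˣ) : 𝔸) := by
  have h := congrFun (hOp_hAverage_gaugeTransformZd hL hd V hV hu hε₀ hsm h44 hV₁ hV₂ hsmV hωV hbudV hU₁ hU₂ h44U
    hsmU hωU hbudU (fun _ => X)) (b0Z L c)
  rw [hOp_apply_b₀ (b0Z_injective hL), rotB_apply, rotB_apply, hOp_apply_b₀ (b0Z_injective hL)] at h
  exact h

/-- The same with the § 1 witnesses at `V^u` (a convenience form). [cite: Balaban1987RG1, p.267] -/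
theorem hOp_hAverage_gaugeTransformZd' (hL : 0 < L) (hd : 1 ≤ d) (V : ZdEdge d → 𝔸ˣ) (hV : ∀ b, V b ∈ U1 𝔸)
    {u : (Fin d → ℤ) → 𝔸ˣ} (hu : ∀ z, u z ∈ U1 𝔸) {ε₀ : ℝ} (hε₀ : 0 ≤ ε₀)
    (hsm : ((d : ℝ) * L) ^ 2 * ε₀ < 1 / 100) (hω : omegaA d L ε₀ ≤ 1 / 8)
    (hbud : (L : ℝ) ^ d / L * (24 * omegaA d L ε₀) < 1)
    (h44 : ∀ (p : Fin d → ℤ) (i j : Fin d), i ≠ j → ‖((plaquetteHolonomyZd V p i j : 𝔸ˣ) : 𝔸) - 1‖ ≤ ε₀)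
    (B : ZdEdge d → 𝔸) :
    hOp (b0Z L) (fun c X => hAverage hL hd (gaugeTransformZd u V)
        (fun b => (mem_U1.1 (mem_U1_gaugeTransformZd hV hu b)).1)
        (fun b => (mem_U1.1 (mem_U1_gaugeTransformZd hV hu b)).2) hε₀
        (plaq_gaugeTransformZd_le V hu h44) hsm.le hω hbud c X) (rotB (fun y => u (blockBase L y)) B)
      = rotB u (hOp (b0Z L) (fun c X => hAverage hL hd V (fun b => (mem_U1.1 (hV b)).1)
          (fun b => (mem_U1.1 (hV b)).2) hε₀ h44 hsm.le hω hbud c X) B) :=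
  hOp_hAverage_gaugeTransformZd hL hd V hV hu hε₀ hsm h44 _ _ _ _ _ _ _ _ _ _ _ B

/-! ## § 3  The remainder `C̃ = Q̃ − LQ̃` of p. 267 under (2.16), on the quantitative small-field ball -/

section Ctilde

variable {V : ZdEdge d → 𝔸ˣ} {B : ZdEdge d → 𝔸} {β ε₀ : ℝ}

/-- The size bookkeeping of the bond perturbation `V′V = e^{iB′}V` on the ball `sup‖B′‖·dL ≤ 1/1200`:
`ρ = e^{β} − 1`, `(1 + ρ)^{dL} − 1 ≤ Θ := y/(1 − y) < 1/600` for `y = β·dL` (the `s = 1` case of the line bookkeeping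
behind `B12QtildeRemainder123.analyticAt_Qtilde_smul`). [folklore] -/
private theorem theta_of_ball (hV : ∀ b, V b ∈ U1 𝔸) (hB : ∀ b, ‖B b‖ ≤ β) (c : ZdEdge d)
    (hβ : β * ((d : ℝ) * L) ≤ 1 / 1200) :
    ∃ ρ Θ : ℝ, 0 ≤ ρ ∧ (1 + ρ) ^ (d * L) - 1 ≤ Θ ∧ Θ < 1 / 600 ∧
      (∀ b, ‖((pert B V b : 𝔸ˣ) : 𝔸) - V b‖ ≤ ρ) ∧
      (∀ b, ‖(((pert B V b)⁻¹ : 𝔸ˣ) : 𝔸) - (((V b)⁻¹ : 𝔸ˣ) : 𝔸)‖ ≤ ρ) := by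
  have hβ0 : 0 ≤ β := (norm_nonneg _).trans (hB c)
  set y : ℝ := β * ((d : ℝ) * L) with hy
  have hy0 : 0 ≤ y := by positivity
  have hy1 : y < 1 := by linarith
  have hpert : ∀ b, ‖((pert B V b : 𝔸ˣ) : 𝔸) - V b‖ ≤ Real.exp β - 1 ∧
      ‖(((pert B V b)⁻¹ : 𝔸ˣ) : 𝔸) - (((V b)⁻¹ : 𝔸ˣ) : 𝔸)‖ ≤ Real.exp β - 1 := by
    intro b
    have h := norm_pert_smul_sub_le hV hB (1 : ℂ) b
    rw [one_smul, norm_one, one_mul] at h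
    exact h
  refine ⟨Real.exp β - 1, y / (1 - y), sub_nonneg.2 (Real.one_le_exp hβ0), ?_, ?_,
    fun b => (hpert b).1, fun b => (hpert b).2⟩
  · have hpow : (1 + (Real.exp β - 1)) ^ (d * L) - 1 = Real.exp y - 1 := by
      rw [add_sub_cancel, ← Real.exp_nat_mul, show ((d * L : ℕ) : ℝ) * β = y by rw [hy]; push_cast; ring]
    rw [hpow]
    have h := Real.exp_bound_div_one_sub_of_interval hy0 hy1
    have hne : 1 - y ≠ 0 := by linarith
    have : y / (1 - y) = 1 / (1 - y) - 1 := by field_simp; ring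
    linarith
  · rw [div_lt_iff₀ (by linarith)]
    linarith

/-- **THE FINITE (2.16)-COVARIANCE OF `Q̃` WITH ITS DOMAIN HYPOTHESES DISCHARGED ON THE BALL**: at a bondwise-`U1`,
`ε₀`-regular `V` with `(dL)²ε₀ ≤ 1/200` (`d ≥ 1`), a `U1`-valued gauge function `u`, and `sup_b‖B′(b)‖·dL ≤ 1/1200`,
`Q̃_{V^u}(R(u)B′)(c) = u(Lc₋) Q̃_V(B′)(c) u(Lc₋)⁻¹` — the (0.12) loops of `V` are `ω_A(ε₀) ≤ 1/20`-close to `1`, those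
of `V′V` within a further `22Θ`, and `‖M(V′V)M(V)⁻¹ − 1‖ ≤ 36Θ`, `Θ < 1/600`, so all three logarithms of (2.4)/(0.12)
are in their series domain and `B12Average012Covariance.Qtilde_gaugeTransformZd` applies.
[cite: Balaban1987RG1, (2.4) p.266] -/
theorem Qtilde_gaugeTransformZd_of_ball (hL : 0 < L) (hd : 1 ≤ d) (hV : ∀ b, V b ∈ U1 𝔸)
    {u : (Fin d → ℤ) → 𝔸ˣ} (hu : ∀ z, u z ∈ U1 𝔸) (hε₀ : 0 ≤ ε₀) (hsm : ((d : ℝ) * L) ^ 2 * ε₀ ≤ 1 / 200)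
    (h44 : ∀ (p : Fin d → ℤ) (i j : Fin d), i ≠ j → ‖((plaquetteHolonomyZd V p i j : 𝔸ˣ) : 𝔸) - 1‖ ≤ ε₀)
    (hB : ∀ b, ‖B b‖ ≤ β) (hβ : β * ((d : ℝ) * L) ≤ 1 / 1200) (c : ZdEdge d) :
    Qtilde L (fun U : ZdEdge d → 𝔸ˣ => Tavg L U) (gaugeTransformZd u V) (rotB u B) c
      = (u (blockBase L c.1) : 𝔸) * Qtilde L (fun U : ZdEdge d → 𝔸ˣ => Tavg L U) V B c
          * (((u (blockBase L c.1))⁻¹ : 𝔸ˣ) : 𝔸) := by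
  obtain ⟨ρ, Θ, hρ, hρΘ, hΘ, h1, h2⟩ := theta_of_ball hV hB c hβ
  have hω : omegaA d L ε₀ ≤ 1 / 20 := by
    have : omegaA d L ε₀ = 10 * (((d : ℝ) * L) ^ 2 * ε₀) := by unfold omegaA; ring
    rw [this]; linarith
  have hsm' : ((d : ℝ) * L) ^ 2 * ε₀ ≤ 1 / 100 := hsm.trans (by norm_num)
  have hW0 : ∀ x ∈ offAxis L c,
      ‖((loopW L (fun U : ZdEdge d → 𝔸ˣ => Tavg L U) V c x : 𝔸ˣ) : 𝔸) - 1‖ ≤ 1 / 20 := fun x hx =>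
    (norm_loopW_Tavg_sub_one_le_all hL hd hV hε₀ hsm' h44 c x (mem_blockSites_of_mem_offAxis hx)).trans hω
  have hW : ∀ x ∈ offAxis L c,
      ‖((loopW L (fun U : ZdEdge d → 𝔸ˣ => Tavg L U) V c x : 𝔸ˣ) : 𝔸) - 1‖ < 1 := fun x hx =>
    (hW0 x hx).trans_lt (by norm_num)
  have hW' : ∀ x ∈ offAxis L c,
      ‖((loopW L (fun U : ZdEdge d → 𝔸ˣ => Tavg L U) (pert B V) c x : 𝔸ˣ) : 𝔸) - 1‖ < 1 := by
    intro x hx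
    have hb := hW0 x hx
    have hdiff := norm_loopW_sub_le hL hd hV hρ hρΘ hΘ.le h1 h2 hε₀ hsm h44 c x
    have htri := norm_sub_le_norm_sub_add_norm_sub
      ((loopW L (fun U : ZdEdge d → 𝔸ˣ => Tavg L U) (pert B V) c x : 𝔸ˣ) : 𝔸)
      ((loopW L (fun U : ZdEdge d → 𝔸ˣ => Tavg L U) V c x : 𝔸ˣ) : 𝔸) 1
    linarith
  have hQ : ‖((avgBar L (pert B V) c * (avgBar L V c)⁻¹ : 𝔸ˣ) : 𝔸) - 1‖ < 1 := by
    have h := norm_avgM_mul_inv_sub_one_le hL hd hV hρ hρΘ hΘ.le h1 h2 hε₀ hsm h44 c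
    exact h.trans_lt (by linarith)
  exact Qtilde_gaugeTransformZd hL hu B V c hW hW' hQ

/-- **THE REMAINDER `C̃ = Q̃ − LQ̃` OF P. 267 IS COVARIANT UNDER (2.16)** («LQ̃B′ + C̃(B′)»; the nonlinear part of the
expression under the `δ`-function of (2.10), whose quadratic part `C̃⁽²⁾ = D̃⁽²⁾` enters (2.12)): on the ball
`sup_b‖B′(b)‖·dL ≤ 1/1200` at a bondwise-`U1`, `ε₀`-regular `V` (`(dL)²ε₀ ≤ 1/200`, `d ≥ 1`), for every `U1`-valued `u`,
`C̃_{V^u}(R(u)B′)(c) = u(Lc₋) C̃_V(B′)(c) u(Lc₋)⁻¹` — the covariances of `Q̃` (`Qtilde_gaugeTransformZd_of_ball`) and of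
`LQ̃` (`B12Average012QtildeCovariance.LQ_gaugeTransformZd`) subtracted. [cite: Balaban1987RG1, p.267] -/
theorem Ctilde_gaugeTransformZd (hL : 0 < L) (hd : 1 ≤ d) (hV : ∀ b, V b ∈ U1 𝔸)
    {u : (Fin d → ℤ) → 𝔸ˣ} (hu : ∀ z, u z ∈ U1 𝔸) (hε₀ : 0 ≤ ε₀) (hsm : ((d : ℝ) * L) ^ 2 * ε₀ ≤ 1 / 200)
    (h44 : ∀ (p : Fin d → ℤ) (i j : Fin d), i ≠ j → ‖((plaquetteHolonomyZd V p i j : 𝔸ˣ) : 𝔸) - 1‖ ≤ ε₀)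
    (hB : ∀ b, ‖B b‖ ≤ β) (hβ : β * ((d : ℝ) * L) ≤ 1 / 1200) (c : ZdEdge d) :
    Qtilde L (fun U : ZdEdge d → 𝔸ˣ => Tavg L U) (gaugeTransformZd u V) (rotB u B) c
        - LQ L (fun U : ZdEdge d → 𝔸ˣ => Tavg L U) (gaugeTransformZd u V) (rotB u B) c
      = (u (blockBase L c.1) : 𝔸)
          * (Qtilde L (fun U : ZdEdge d → 𝔸ˣ => Tavg L U) V B c - LQ L (fun U : ZdEdge d → 𝔸ˣ => Tavg L U) V B c)
          * (((u (blockBase L c.1))⁻¹ : 𝔸ˣ) : 𝔸) := by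
  have hsm' : ((d : ℝ) * L) ^ 2 * ε₀ < 1 / 100 := by linarith
  rw [Qtilde_gaugeTransformZd_of_ball hL hd hV hu hε₀ hsm h44 hB hβ c,
    LQ_gaugeTransformZd hL hd V hV hu hε₀ hsm' h44 B c, mul_sub, sub_mul]

end Ctilde


/-! ## § 4  The same letters as self-maps of `ℓ^∞` (`B12LinearizationGenuineZd`), and the covariance of `D̃` -/

section Field

open B12LinearizationGenuineZd (BField LQfield hfield Cfield hc LQfield_apply hfield_apply Cfield_apply)

omit [NormedAlgebra ℂ 𝔸] [CompleteSpace 𝔸] in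
/-- `‖w X w⁻¹‖ ≤ ‖X‖` for `w ∈ U1`. [folklore] -/
private theorem norm_units_conj_le {w : 𝔸ˣ} (hw : w ∈ U1 𝔸) (X : 𝔸) :
    ‖(w : 𝔸) * X * ((w⁻¹ : 𝔸ˣ) : 𝔸)‖ ≤ ‖X‖ := by
  obtain ⟨h1, h2⟩ := mem_U1.1 hw
  calc ‖(w : 𝔸) * X * ((w⁻¹ : 𝔸ˣ) : 𝔸)‖ ≤ ‖(w : 𝔸)‖ * ‖X‖ * ‖((w⁻¹ : 𝔸ˣ) : 𝔸)‖ :=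
        (norm_mul_le _ _).trans (mul_le_mul_of_nonneg_right (norm_mul_le _ _) (norm_nonneg _))
    _ ≤ 1 * ‖X‖ * 1 := by gcongr
    _ = ‖X‖ := by ring

/-- (2.16) `B′ → R(w)B′` as a self-map of the Banach space `ℓ^∞` of bounded bond fields (`w ∈ U1` pointwise keeps
the sup norm). [cite: Balaban1987RG1, (2.16) p.269] -/
def rotBF (w : (Fin d → ℤ) → 𝔸ˣ) (hw : ∀ z, w z ∈ U1 𝔸) (Y : BField d 𝔸) : BField d 𝔸 :=
  ⟨rotB w ⇑Y, memℓp_infty ⟨‖Y‖, by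
    rintro _ ⟨b, rfl⟩
    exact (norm_units_conj_le (hw b.1) (Y b)).trans (lp.norm_apply_le_norm ENNReal.top_ne_zero Y b)⟩⟩

omit [NormedAlgebra ℂ 𝔸] [CompleteSpace 𝔸] in
/-- Unfolding of `rotBF`. [cite: Balaban1987RG1, (2.16) p.269] -/
theorem coe_rotBF (w : (Fin d → ℤ) → 𝔸ˣ) (hw : ∀ z, w z ∈ U1 𝔸) (Y : BField d 𝔸) :
    ((rotBF w hw Y : BField d 𝔸) : ZdEdge d → 𝔸) = rotB w ⇑Y := rfl

omit [NormedAlgebra ℂ 𝔸] [CompleteSpace 𝔸] in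
/-- `R(w)` does not increase the sup norm. [cite: Balaban1987RG1, (2.16) p.269] -/
theorem norm_rotBF_le (w : (Fin d → ℤ) → 𝔸ˣ) (hw : ∀ z, w z ∈ U1 𝔸) (Y : BField d 𝔸) :
    ‖rotBF w hw Y‖ ≤ ‖Y‖ :=
  lp.norm_le_of_forall_le (norm_nonneg _) fun b =>
    (norm_units_conj_le (hw b.1) (Y b)).trans (lp.norm_apply_le_norm ENNReal.top_ne_zero Y b)

omit [NormedAlgebra ℂ 𝔸] [CompleteSpace 𝔸] in
/-- `R(w⁻¹)R(w) = 1` on `ℓ^∞`. [cite: Balaban1987RG1, (2.16) p.269] -/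
theorem rotBF_inv_rotBF (w : (Fin d → ℤ) → 𝔸ˣ) (hw : ∀ z, w z ∈ U1 𝔸) (Y : BField d 𝔸) :
    rotBF w⁻¹ (fun z => (U1 𝔸).inv_mem (hw z)) (rotBF w hw Y) = Y :=
  lp.ext (by rw [coe_rotBF, coe_rotBF, rotB_inv_rotB])

omit [NormedAlgebra ℂ 𝔸] [CompleteSpace 𝔸] in
/-- `R(w)` is an ISOMETRY of the sup norm. [cite: Balaban1987RG1, (2.16) p.269] -/
theorem norm_rotBF (w : (Fin d → ℤ) → 𝔸ˣ) (hw : ∀ z, w z ∈ U1 𝔸) (Y : BField d 𝔸) :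
    ‖rotBF w hw Y‖ = ‖Y‖ := by
  refine le_antisymm (norm_rotBF_le w hw Y) ?_
  have h := norm_rotBF_le w⁻¹ (fun z => (U1 𝔸).inv_mem (hw z)) (rotBF w hw Y)
  rwa [rotBF_inv_rotBF] at h

omit [NormedAlgebra ℂ 𝔸] [CompleteSpace 𝔸] in
/-- `R(w)` is additive: `R(w)(Y − Z) = R(w)Y − R(w)Z`. [cite: Balaban1987RG1, (2.16) p.269] -/
theorem rotBF_sub (w : (Fin d → ℤ) → 𝔸ˣ) (hw : ∀ z, w z ∈ U1 𝔸) (Y Z : BField d 𝔸) :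
    rotBF w hw (Y - Z) = rotBF w hw Y - rotBF w hw Z := by
  refine lp.ext (funext fun b => ?_)
  simp only [lp.coeFn_sub, coe_rotBF, Pi.sub_apply, rotB_apply, mul_sub, sub_mul]

omit [NormedAlgebra ℂ 𝔸] [CompleteSpace 𝔸] in
/-- `R(w)0 = 0`. [cite: Balaban1987RG1, (2.16) p.269] -/
theorem rotBF_zero (w : (Fin d → ℤ) → 𝔸ˣ) (hw : ∀ z, w z ∈ U1 𝔸) : rotBF w hw (0 : BField d 𝔸) = 0 := by
  refine lp.ext (funext fun b => ?_)
  simp only [coe_rotBF, lp.coeFn_zero, rotB_apply, Pi.zero_apply, mul_zero, zero_mul]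

variable (hL : 0 < L) (hd : 1 ≤ d) (V : ZdEdge d → 𝔸ˣ) (hV : ∀ b, V b ∈ U1 𝔸) {u : (Fin d → ℤ) → 𝔸ˣ}
  (hu : ∀ z, u z ∈ U1 𝔸) {ε₀ : ℝ} (hε₀ : 0 ≤ ε₀) (hsm : ((d : ℝ) * L) ^ 2 * ε₀ ≤ 1 / 200)
  (h44 : ∀ (p : Fin d → ℤ) (i j : Fin d), i ≠ j → ‖((plaquetteHolonomyZd V p i j : 𝔸ˣ) : 𝔸) - 1‖ ≤ ε₀)
  (hbud : (L : ℝ) ^ d / L * (24 * omegaA d L ε₀) < 1)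

/-- **`h` ON `ℓ^∞` IS COVARIANT**: `h_{V^u}(R(u)X) = R(u)(h_V X)` for `B12LinearizationGenuineZd.hfield` (coarse
rotation by `u(L·c₋)`, fine by `u(b₋)`). [cite: Balaban1987RG1, p.267] -/
theorem hfield_gaugeTransformZd (X : BField d 𝔸) :
    hfield hL hd (gaugeTransformZd u V) (mem_U1_gaugeTransformZd hV hu) hε₀ hsm
        (plaq_gaugeTransformZd_le V hu h44) hbud
        (rotBF (fun y => u (blockBase L y)) (fun _ => hu _) X)
      = rotBF u hu (hfield hL hd V hV hε₀ hsm h44 hbud X) := by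
  refine lp.ext ?_
  rw [hfield_apply, coe_rotBF, coe_rotBF, hfield_apply]
  unfold B12LinearizationGenuineZd.hc
  exact hOp_hAverage_gaugeTransformZd hL hd V hV hu hε₀ (by linarith) h44 _ _ _ _ _ _ _ _ _ _ _ _

/-- **`C̃` ON `ℓ^∞` IS COVARIANT**: `C̃_{V^u}(R(u)Y) = R(u)C̃_V(Y)` for `B12LinearizationGenuineZd.Cfield` (on its ball
`‖Y‖·dL ≤ 1/1200` by § 3; off it both sides are the file's `0`-extension, `R(u)` being an isometry).
[cite: Balaban1987RG1, p.267] -/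
theorem Cfield_gaugeTransformZd (Y : BField d 𝔸) :
    Cfield hL hd (gaugeTransformZd u V) (mem_U1_gaugeTransformZd hV hu) hε₀ hsm
        (plaq_gaugeTransformZd_le V hu h44) (rotBF u hu Y)
      = rotBF (fun y => u (blockBase L y)) (fun _ => hu _) (Cfield hL hd V hV hε₀ hsm h44 Y) := by
  by_cases hY : ‖Y‖ * ((d : ℝ) * L) ≤ 1 / 1200
  · have hY' : ‖rotBF u hu Y‖ * ((d : ℝ) * L) ≤ 1 / 1200 := by rwa [norm_rotBF]
    refine lp.ext (funext fun c => ?_)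
    rw [Cfield_apply _ _ _ _ _ _ _ _ hY', coe_rotBF, coe_rotBF, rotB_apply, Cfield_apply _ _ _ _ _ _ _ _ hY]
    exact Ctilde_gaugeTransformZd hL hd hV hu hε₀ hsm h44
      (fun b => lp.norm_apply_le_norm ENNReal.top_ne_zero Y b) hY c
  · have hY' : ¬ ‖rotBF u hu Y‖ * ((d : ℝ) * L) ≤ 1 / 1200 := by rwa [norm_rotBF]
    simp only [B12LinearizationGenuineZd.Cfield, dif_neg hY', dif_neg hY, rotBF_zero]

/-- **THE FUNCTION `D̃` OF P. 267 IS COVARIANT UNDER (2.16)** («there exists exactly one solution of this equation»):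
if `D̃_V` solves the fixed-point equation `C̃_V(B − hD̃_V(B)) = D̃_V(B)` in the ball of radius `r` for `‖B‖ < ε`
(existence clause of `B12LinearizationGenuineZd.p267_genuine` at `V`) and `D̃_{V^u}` is the unique such solution at
`V^u` (its uniqueness clause at `V^u`, same `ε`, `r`), then `D̃_{V^u}(R(u)B) = R(u)D̃_V(B)` for `‖B‖ < ε` — by the
covariance of `h` and `C̃` the rotated solution solves the rotated equation. [cite: Balaban1987RG1, p.267] -/
theorem Dtilde_gaugeTransformZd {ε r : ℝ} {DtV DtU : BField d 𝔸 → BField d 𝔸}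
    (hDtV : ∀ B : BField d 𝔸, ‖B‖ < ε →
      DtV B ∈ Metric.closedBall (0 : BField d 𝔸) r ∧
      Cfield hL hd V hV hε₀ hsm h44 (B - hfield hL hd V hV hε₀ hsm h44 hbud (DtV B)) = DtV B)
    (hDtU : ∀ B : BField d 𝔸, ‖B‖ < ε → ∀ X ∈ Metric.closedBall (0 : BField d 𝔸) r,
      Cfield hL hd (gaugeTransformZd u V) (mem_U1_gaugeTransformZd hV hu) hε₀ hsm (plaq_gaugeTransformZd_le V hu h44)
          (B - hfield hL hd (gaugeTransformZd u V) (mem_U1_gaugeTransformZd hV hu) hε₀ hsm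
            (plaq_gaugeTransformZd_le V hu h44) hbud X) = X →
        X = DtU B)
    (B : BField d 𝔸) (hB : ‖B‖ < ε) :
    DtU (rotBF u hu B) = rotBF (fun y => u (blockBase L y)) (fun _ => hu _) (DtV B) := by
  obtain ⟨hball, hfix⟩ := hDtV B hB
  symm
  refine hDtU (rotBF u hu B) (by rwa [norm_rotBF]) _ ?_ ?_
  · rw [Metric.mem_closedBall, dist_zero_right, norm_rotBF]
    rwa [Metric.mem_closedBall, dist_zero_right] at hball
  · rw [hfield_gaugeTransformZd hL hd V hV hu hε₀ hsm h44 hbud, ← rotBF_sub,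
      Cfield_gaugeTransformZd hL hd V hV hu hε₀ hsm h44, hfix]

end Field

end Literature.MathematicalPhysics.QuantumFieldTheory.Balaban1983to89.B12Def267Covariance

end
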